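import Summits.QuantumFields.YangMills.Theorems.AllWindowsColdBoxBoxHighLineK3PrimeRowE2
import Summits.QuantumFields.YangMills.Theorems.AllWindowsColdBoxBoxHighLineConnectedFourPointCubicMuSet
import Summits.QuantumFields.YangMills.Theorems.AllWindowsColdBoxBoxHighLineRestrictionSetCum3

/-!
# K3′ ROW E2 (odd row) ON THE CUT SET `μ_{D′}` — `|κ₃,₀^{μ_{D′}}(c^{odd,(3)}_x, L_q; P)| ≤ C·B₀·B·(1+log H)⁵·(1 + √τ·H²)·β⁻³`, and the row form

Width seat `ym-line-sfw-p2-w5` (prover-ym-line-sfw-p2-w5-g24-0), cell ym-idea-1; U5 prep, helper-grade (planner ym-idea-2 g18's board 2026-08-30T01:22:16Z: «E2's μ_{D′}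
transfer + β-corollary»; ASSEMBLY-U5 §8, LINE-20 ⟨stmt-QuantumFields-24336⟩).  fcl-p3 g27's ✓`GaussRestrict.abs_tiltCum3_muSet_zero_le_rows` splits
`κ₃,₀^{μ_{D′}}(X,Y;U)` into rows; its exact ODD row is `E2 = |κ₃,₀(Cx, Ly; P) + κ₃,₀(Lx, Cy; P)|` with `Cx a = tripleForm T₀ (plaqVar_x a)` (the cubic Taylor form of the
odd plaquette cost, `|T₀| ≤ B₀`), `Ly = linCurvSq`, and `P a = β·Σ_{p∈PT} tripleForm (Tc p) (plaqVar_p a)` the cubic vertex (`|Tc p| ≤ B`; the sign of `P` is free: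
`Tc ↦ −Tc`, ✓`tripleFormSum_neg_left`).  ✓`abs_gaussAvg_tripleForm_mul_centredLinCurvSq_mul_tripleFormSum_le` (this seat, ✓p754605) is the size of the E₀-exact core
`E₀[Cx·L̃_q·P]`; this file moves it onto `μ_{D′}` exactly as LEAD g78's ✓`abs_tiltCum4_muSet_cubicPair_le` moved the κ₄ cubic pair (fcl-p3's centred transfer
✓`GaussRestrict.abs_tiltCum3_muSet_zero_sub_gaussAvg_centred_le`, the seven Gaussian sizes as PERFECT SQUARES from Bonami–Nelson ✓`gaussAvg_sq_mul_sq_le_of_polyCert`,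
parity ✓`gaussAvg_eq_zero_of_odd` killing `E₀Cx` and `E₀P`):

* `gaussAvg_tripleForm_sq_le` — `E₀[(tripleForm T₀ (plaqVar_x))²] ≤ C·B₀²·(1+log H)³·β⁻¹^3` (✓`abs_integral_tripleForm_mul_tripleForm_le` + ✓`cross_propagator_le`);
* `tiltCum3_comm` — `κ₃,t(X,Y;U) = κ₃,t(Y,X;U)`;
* ★★ `abs_tiltCum3_muSet_tripleForm_linCurvSq_le` — for `H ≥ 1`, `β > 0`, `|T₀| ≤ B₀`, `|Tc p| ≤ B`, all `x μ ν`, `y μ′ ν′`, `0 ≤ s`, measurable `D ⊆ smallField H s`,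
  `E₀[1 − 1_D] ≤ τ ≤ 1/2`:  `|Tilt.tiltCum3 μ_D P 0 (tripleForm T₀ ∘ plaqVar_x) (linCurvSq H (y,μ′,ν′))| ≤ C·B₀·B·(1+log H)⁵·(1 + √τ·H²)·β⁻¹^3`
  (transfer error `√τ·5816·u₁uv`, `u₁² = C₁B₀²L³β⁻³`, `u² = C_V L²β⁻²`, `v² = C_T B²H⁴L³β⁻¹`);
* ★★ `abs_tiltCum3_muSet_linCurvSq_tripleForm_le` — the same with the cubic form in the second slot;
* ★★ `abs_tiltCum3_muSet_rowE2_le` — the ROW in the letters of ✓`abs_tiltCum3_muSet_zero_le_rows` (`Lz = linCurvSq H (plaq12At z)`, `Cz = tripleForm (T z) ∘ plaqVar_z 1 2`):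
  `|κ₃,₀(Cx, Ly; P) + κ₃,₀(Lx, Cy; P)| ≤ 2·C·B₀·B·(1+log H)⁵·(1 + √τ·H²)·β⁻¹^3` for all `x y`.
Relative to the assembler's floor `40e/H⁸·β⁻¹`: `H⁸(1+log H)⁵/β²·(1 + √τ·H²)` — no constraint on `θ`; no `s`-dependence.

Tree only; no definitions; standard axioms.  HONEST LABEL: helper-grade U5 prep (one row of hK3′ on the cut set); U5 ⟨24336⟩ UNSTAFFED/OPEN, ⟨24004⟩ OPEN, this seat's
line crux ⟨22884⟩ OPEN; route AllWindowsColdBox DRAFT; no crux, rung or summit is proved; **the Yang–Mills mass gap is NOT proved by this file; no summit is proved by a line.**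
-/

set_option autoImplicit false

noncomputable section

open MeasureTheory Matrix Finset
open scoped Kronecker
open Literature.Probability.LatticeModels (Site)
open Literature.MathematicalPhysics.QuantumLattice (ZdPlaquette plaquettesTouching)
open Literature.MathematicalPhysics.QuantumFieldTheory (Plaq)
open Literature.MathematicalPhysics.QuantumFieldTheory.AxialGauge (boxEdges)
open Summit.QuantumFields.YangMills.Theorems.WeakCouplingRates (plaq12At)

namespace Summit.QuantumFields.YangMills.Theorems.AllWindowsColdBoxBoxHighLine

namespace EdgeChartGaussian

open LaplaceSandwich (flatten)

/-! ## §1 The second moment of one cubic plaquette form, and the symmetry of `κ₃` -/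

/-- **`E₀[(tripleForm T₀ (plaqVar_x a))²] ≤ C·B₀²·(1+log H)³·β⁻¹^3`** (the pair bound ✓`abs_integral_tripleForm_mul_tripleForm_le` at `x = y` with the uniform
cross-propagator size `(2β)⁻¹·9C(1+log H)` of ✓`cross_propagator_le`). -/
theorem gaussAvg_tripleForm_sq_le : ∃ C : ℝ, 0 ≤ C ∧ ∀ H : ℕ, 1 ≤ H → ∀ β : ℝ, 0 < β → ∀ B₀ : ℝ,
    ∀ T₀ : Fin 4 → Fin 4 → Fin 4 → ℝ, (∀ i j k, |T₀ i j k| ≤ B₀) → ∀ x : Site 4, ∀ μ ν : Fin 4,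
    gaussAvg β H (fun a => tripleForm T₀ (plaqVar H x μ ν a) ^ 2) ≤ C * B₀ ^ 2 * (1 + Real.log H) ^ 3 * β⁻¹ ^ 3 := by
  obtain ⟨C, hC0, hC⟩ := cross_propagator_le
  refine ⟨15 * 384 ^ 2 * 9 ^ 3 / 8 * C ^ 3, by positivity, fun H hH β hβ B₀ T₀ hT₀ x μ ν => ?_⟩
  have hL0 : 0 ≤ 1 + Real.log H := by
    have : (1 : ℝ) ≤ H := by exact_mod_cast hH
    linarith [Real.log_nonneg this]
  have hM0 : 0 ≤ (2 * β)⁻¹ * (9 * C * (1 + Real.log H)) := by positivity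
  have hcross : ∀ (e e' : LandauFree H) (i i' : Fin 4),
      (e.1.1 : Literature.MathematicalPhysics.QuantumLattice.ZdEdge 4) = plaqEdge x μ ν i →
      (e'.1.1 : Literature.MathematicalPhysics.QuantumLattice.ZdEdge 4) = plaqEdge x μ ν i' →
      ∀ c c' : Fin 3, |(2 * β)⁻¹ * (if c = c' then (hodgeQ H)⁻¹ e e' else 0)| ≤ (2 * β)⁻¹ * (9 * C * (1 + Real.log H)) := by
    intro e e' i i' he he' c c'
    refine (hC H hH β hβ x x μ ν μ ν e e' i i' he he' c c').trans (mul_le_mul_of_nonneg_left ?_ (by positivity))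
    exact div_le_self (by positivity) (one_le_pow₀ (by linarith [GhostKernel.siteDist_nonneg x x]))
  have h := abs_integral_tripleForm_mul_tripleForm_le H hβ x x μ ν μ ν T₀ T₀ hT₀ hT₀ hM0 hcross
  obtain ⟨Z, hZdef⟩ : ∃ Z : ℝ, (∫ a : LandauFree H → EuclideanSpace ℝ (Fin 3),
      Real.exp (-(β * ∑ c : Fin 3, (fun e => a e c) ⬝ᵥ (hodgeQ H *ᵥ fun e => a e c)))) = Z := ⟨_, rfl⟩
  have hZ : 0 < Z := by
    rw [← hZdef]; exact integral_exp_neg_colourForm_pos (hodgeQ H) (hodgeQ_posDef H) hβ (I := LandauFree H)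
  have hZ' : Real.sqrt (Real.pi / β) ^ Fintype.card (LandauFree H × Fin 3) /
      Real.sqrt (hodgeQ H ⊗ₖ (1 : Matrix (Fin 3) (Fin 3) ℝ)).det = Z := by
    rw [← hZdef, integral_exp_neg_colourForm (hodgeQ H) (hodgeQ_posDef H) hβ]
  rw [hZ'] at h
  have hden : (∫ a : LandauFree H → E3, gaussWeight β H a) = Z := by rw [← hZdef]; rfl
  have hnum : (∫ a : LandauFree H → E3, tripleForm T₀ (plaqVar H x μ ν a) ^ 2 * gaussWeight β H a) =
      ∫ a : LandauFree H → E3, tripleForm T₀ (plaqVar H x μ ν a) * tripleForm T₀ (plaqVar H x μ ν a) *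
        Real.exp (-(β * ∑ c : Fin 3, (fun e => a e c) ⬝ᵥ (hodgeQ H *ᵥ fun e => a e c))) := by
    congr 1; funext a; rw [sq, gaussWeight_eq]
  unfold gaussAvg
  rw [hden, div_le_iff₀ hZ, hnum]
  refine (le_abs_self _).trans (h.trans (le_of_eq ?_))
  rw [mul_inv]
  ring

/-- `κ₃,t` is symmetric in its two observable slots. -/
theorem tiltCum3_comm {Ω : Type*} [MeasurableSpace Ω] (μ : Measure Ω) (U : Ω → ℝ) (t : ℝ) (X Y : Ω → ℝ) :
    Tilt.tiltCum3 μ U t X Y = Tilt.tiltCum3 μ U t Y X := by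
  unfold Tilt.tiltCum3
  congr 1; funext ω; ring

/-! ## §2 The odd row on `μ_{D′}` -/

/-- ★★ **K3′ row E2 on the cut set, cubic form in the first slot** (see the module docstring). -/
theorem abs_tiltCum3_muSet_tripleForm_linCurvSq_le : ∃ C : ℝ, 0 ≤ C ∧ ∀ H : ℕ, 1 ≤ H → ∀ β : ℝ, 0 < β →
    ∀ B₀ B : ℝ, ∀ T₀ : Fin 4 → Fin 4 → Fin 4 → ℝ, (∀ i j k, |T₀ i j k| ≤ B₀) →
    ∀ Tc : ZdPlaquette 4 → Fin 4 → Fin 4 → Fin 4 → ℝ, (∀ p i j k, |Tc p i j k| ≤ B) →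
    ∀ x : Site 4, ∀ μ ν : Fin 4, ∀ y : Site 4, ∀ μ' ν' : Fin 4,
    ∀ s : ℝ, 0 ≤ s → ∀ D : Set (LandauFree H → E3), MeasurableSet D → D ⊆ smallField H s →
    ∀ τ : ℝ, gaussAvg β H (fun a => 1 - D.indicator (fun _ => (1 : ℝ)) a) ≤ τ → τ ≤ 1 / 2 →
    |Tilt.tiltCum3 ((((volume : Measure (LandauFree H → E3)).restrict D).withDensity fun a => ENNReal.ofReal (gaussWeight β H a)))
        (fun a => β * ∑ p ∈ plaquettesTouching (boxEdges 4 (2 * H + 1)), tripleForm (Tc p) (plaqVar H p.1 p.2.1.1 p.2.1.2 a)) 0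
        (fun a => tripleForm T₀ (plaqVar H x μ ν a)) (linCurvSq H (y, μ', ν'))| ≤
      C * B₀ * B * (1 + Real.log H) ^ 5 * (1 + Real.sqrt τ * (H : ℝ) ^ 2) * β⁻¹ ^ 3 := by
  obtain ⟨CE, hCE0, hE⟩ := abs_gaussAvg_tripleForm_mul_centredLinCurvSq_mul_tripleFormSum_le
  obtain ⟨CV, hCV0, hV⟩ := gaussAvg_centred_linCurvSq_sq_le
  obtain ⟨CTB₀, hTB⟩ := tripleBond_gaussAvg_le
  obtain ⟨C₁, hC₁0, h1⟩ := gaussAvg_tripleForm_sq_le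
  refine ⟨CE + 5816 * Real.sqrt CV * Real.sqrt (C₁ * max CTB₀ 0), by positivity,
    fun H hH β hβ B₀ B T₀ hT₀ Tc hT x μ ν y μ' ν' s hs0 D hDm hDs τ hτ hτ2 => ?_⟩
  classical
  set PT := plaquettesTouching (boxEdges 4 (2 * H + 1)) with hPT
  set q : Plaq 4 := (y, μ', ν') with hq
  have hH0 : (0 : ℝ) < H := by exact_mod_cast Nat.lt_of_lt_of_le Nat.zero_lt_one hH
  have hL1 : 1 ≤ 1 + Real.log H := by
    have : (1 : ℝ) ≤ H := by exact_mod_cast hH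
    have := Real.log_nonneg this; linarith
  have hL0 : 0 ≤ 1 + Real.log H := zero_le_one.trans hL1
  have hB₀ : 0 ≤ B₀ := (abs_nonneg _).trans (hT₀ 0 0 0)
  have hB0 : 0 ≤ B := (abs_nonneg _).trans (hT (((0 : Site 4), ⟨(0, 1), by decide⟩) : ZdPlaquette 4) 0 0 0)
  have hτ0 : 0 ≤ τ := le_trans (EdgeChartGaussian.gaussAvg_nonneg H hβ fun a => by
    by_cases ha : a ∈ D <;> simp [Set.indicator, ha]) hτ
  have hβi : 0 ≤ β⁻¹ := inv_nonneg.2 hβ.le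
  have hm0 : 0 ≤ max CTB₀ 0 := le_max_right _ _
  -- ### parity: the cubic form and the cubic vertex are odd
  have hX0 : gaussAvg β H (fun a => tripleForm T₀ (plaqVar H x μ ν a)) = 0 :=
    gaussAvg_eq_zero_of_odd β H fun a => by
      have h : plaqVar H x μ ν (-a) = fun i => -plaqVar H x μ ν a i := funext fun i => WilsonTaylor.plaqVar_neg H x μ ν a i
      rw [h, tripleForm_neg]
  have hP0 : gaussAvg β H (fun a => β * ∑ p ∈ PT, tripleForm (Tc p) (plaqVar H p.1 p.2.1.1 p.2.1.2 a)) = 0 :=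
    gaussAvg_eq_zero_of_odd β H fun a => tripleFormSum_neg H β PT Tc a
  -- ### certificates, measurability, sixth moments
  have hcX := polyCert_tripleForm (H := H) x μ ν T₀ hT₀
  have hcL : ∃ Q : MvPolynomial (LandauFree H × Fin 3) ℝ, Q.totalDegree ≤ 2 ∧
      ∀ a, linCurvSq H q a - gaussAvg β H (linCurvSq H q) = MvPolynomial.eval (flatten (LandauFree H) a) Q :=
    polyCert_sub (polyCert_linCurvSq H q) (polyCert_const _ 2)
  have hcP := polyCert_tripleFormSum H β PT Tc hT
  have mX : Measurable (fun a : LandauFree H → E3 => tripleForm T₀ (plaqVar H x μ ν a)) := measurable_of_polyCert hcX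
  have mL : Measurable (linCurvSq H q) := measurable_linCurvSq H q
  have mP : Measurable (fun a : LandauFree H → E3 => β * ∑ p ∈ PT, tripleForm (Tc p) (plaqVar H p.1 p.2.1.1 p.2.1.2 a)) :=
    measurable_of_polyCert hcP
  have iX : Integrable (fun a : LandauFree H → E3 => tripleForm T₀ (plaqVar H x μ ν a) ^ 6 * gaussWeight β H a) :=
    integrable_polyCert_mul_gaussWeight H hβ (polyCert_pow hcX 6)
  have iL : Integrable (fun a : LandauFree H → E3 => linCurvSq H q a ^ 6 * gaussWeight β H a) :=
    integrable_polyCert_mul_gaussWeight H hβ (polyCert_pow (polyCert_linCurvSq H q) 6)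
  have iP : Integrable (fun a : LandauFree H → E3 => (β * ∑ p ∈ PT, tripleForm (Tc p) (plaqVar H p.1 p.2.1.1 p.2.1.2 a)) ^ 6 * gaussWeight β H a) :=
    integrable_polyCert_mul_gaussWeight H hβ (polyCert_pow hcP 6)
  -- ### on-`D` bounds
  set BD : ℝ := 16 * s ^ 2 + 6 * B₀ * (4 * s) ^ 3 + β * PT.card * (6 * B * (4 * s) ^ 3) with hBD
  have h16 : 0 ≤ 16 * s ^ 2 := by positivity
  have hX3 : 0 ≤ 6 * B₀ * (4 * s) ^ 3 := by positivity
  have hP3 : 0 ≤ β * PT.card * (6 * B * (4 * s) ^ 3) := by positivity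
  have hBD0 : 0 ≤ BD := by positivity
  have hXD : ∀ a ∈ D, |tripleForm T₀ (plaqVar H x μ ν a)| ≤ BD := by
    intro a ha
    refine (abs_tripleForm_le T₀ hT₀ _).trans ?_
    have h3 : 6 * B₀ * (∑ i, ‖plaqVar H x μ ν a i‖) ^ 3 ≤ 6 * B₀ * (4 * s) ^ 3 :=
      mul_le_mul_of_nonneg_left (pow_le_pow_left₀ (Finset.sum_nonneg fun i _ => norm_nonneg _)
        (TiltSup.sum_norm_plaqVar_le hs0 (hDs ha) x μ ν) 3) (by positivity)
    exact h3.trans (by rw [hBD]; linarith)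
  have hLD : ∀ a ∈ D, |linCurvSq H q a| ≤ BD := by
    intro a ha
    have hl := TiltSup.linCurvSq_le hs0 (hDs ha) y μ' ν'
    have h0 : 0 ≤ linCurvSq H q a := Finset.sum_nonneg fun c _ => sq_nonneg _
    rw [abs_of_nonneg h0]
    exact hl.trans (by rw [hBD]; linarith)
  have hPD : ∀ a ∈ D, |β * ∑ p ∈ PT, tripleForm (Tc p) (plaqVar H p.1 p.2.1.1 p.2.1.2 a)| ≤ BD := by
    intro a ha
    rw [abs_mul, abs_of_pos hβ]
    have hterm : ∀ p ∈ PT, |tripleForm (Tc p) (plaqVar H p.1 p.2.1.1 p.2.1.2 a)| ≤ 6 * B * (4 * s) ^ 3 := by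
      intro p _
      refine (abs_tripleForm_le (Tc p) (hT p) _).trans ?_
      exact mul_le_mul_of_nonneg_left (pow_le_pow_left₀ (Finset.sum_nonneg fun i _ => norm_nonneg _)
        (TiltSup.sum_norm_plaqVar_le hs0 (hDs ha) p.1 p.2.1.1 p.2.1.2) 3) (by positivity)
    have hsum : |∑ p ∈ PT, tripleForm (Tc p) (plaqVar H p.1 p.2.1.1 p.2.1.2 a)| ≤ PT.card * (6 * B * (4 * s) ^ 3) := by
      refine (Finset.abs_sum_le_sum_abs _ _).trans ((Finset.sum_le_sum hterm).trans (le_of_eq ?_))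
      rw [Finset.sum_const, nsmul_eq_mul]
    calc β * |∑ p ∈ PT, tripleForm (Tc p) (plaqVar H p.1 p.2.1.1 p.2.1.2 a)| ≤ β * (PT.card * (6 * B * (4 * s) ^ 3)) :=
          mul_le_mul_of_nonneg_left hsum hβ.le
      _ ≤ BD := by rw [hBD, ← mul_assoc]; linarith
  -- ### the three Gaussian letters `u₁, u, v`
  obtain ⟨u₁, hu₁⟩ : ∃ u₁ : ℝ, u₁ = Real.sqrt (C₁ * B₀ ^ 2 * (1 + Real.log H) ^ 3 * β⁻¹ ^ 3) := ⟨_, rfl⟩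
  obtain ⟨u, hu⟩ : ∃ u : ℝ, u = Real.sqrt CV * (1 + Real.log H) * β⁻¹ := ⟨_, rfl⟩
  obtain ⟨v, hv⟩ : ∃ v : ℝ, v = Real.sqrt (max CTB₀ 0 * B ^ 2 * (H : ℝ) ^ 4 * (1 + Real.log H) ^ 3 * β⁻¹) := ⟨_, rfl⟩
  have hA₁0 : 0 ≤ C₁ * B₀ ^ 2 * (1 + Real.log H) ^ 3 * β⁻¹ ^ 3 := by positivity
  have hA₃0 : 0 ≤ max CTB₀ 0 * B ^ 2 * (H : ℝ) ^ 4 * (1 + Real.log H) ^ 3 * β⁻¹ := by positivity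
  have hu₁0 : 0 ≤ u₁ := by rw [hu₁]; exact Real.sqrt_nonneg _
  have hu0 : 0 ≤ u := by rw [hu]; positivity
  have hv0 : 0 ≤ v := by rw [hv]; exact Real.sqrt_nonneg _
  have hu₁2 : u₁ ^ 2 = C₁ * B₀ ^ 2 * (1 + Real.log H) ^ 3 * β⁻¹ ^ 3 := by rw [hu₁]; exact Real.sq_sqrt hA₁0
  have hu2 : u ^ 2 = CV * (1 + Real.log H) ^ 2 * β⁻¹ ^ 2 := by
    rw [hu, mul_pow, mul_pow, Real.sq_sqrt hCV0]
  have hv2 : v ^ 2 = max CTB₀ 0 * B ^ 2 * (H : ℝ) ^ 4 * (1 + Real.log H) ^ 3 * β⁻¹ := by rw [hv]; exact Real.sq_sqrt hA₃0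
  -- the product `u₁·u·v` in letters (the odd powers of `β⁻¹` and of `1 + log H` pair up inside `u₁·v`)
  have h13 : u₁ * v = Real.sqrt (C₁ * max CTB₀ 0) * B₀ * B * (H : ℝ) ^ 2 * (1 + Real.log H) ^ 3 * β⁻¹ ^ 2 := by
    rw [hu₁, hv, ← Real.sqrt_mul hA₁0]
    have hK0 : 0 ≤ Real.sqrt (C₁ * max CTB₀ 0) * B₀ * B * (H : ℝ) ^ 2 * (1 + Real.log H) ^ 3 * β⁻¹ ^ 2 := by positivity
    rw [show C₁ * B₀ ^ 2 * (1 + Real.log H) ^ 3 * β⁻¹ ^ 3 * (max CTB₀ 0 * B ^ 2 * (H : ℝ) ^ 4 * (1 + Real.log H) ^ 3 * β⁻¹) =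
        (Real.sqrt (C₁ * max CTB₀ 0) * B₀ * B * (H : ℝ) ^ 2 * (1 + Real.log H) ^ 3 * β⁻¹ ^ 2) ^ 2 by
      rw [show (Real.sqrt (C₁ * max CTB₀ 0) * B₀ * B * (H : ℝ) ^ 2 * (1 + Real.log H) ^ 3 * β⁻¹ ^ 2) ^ 2 =
          Real.sqrt (C₁ * max CTB₀ 0) ^ 2 * (B₀ ^ 2 * B ^ 2 * (H : ℝ) ^ 4 * (1 + Real.log H) ^ 6 * β⁻¹ ^ 4) by ring,
        Real.sq_sqrt (mul_nonneg hC₁0 hm0)]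
      ring, Real.sqrt_sq hK0]
  have huv : u₁ * u * v = Real.sqrt CV * Real.sqrt (C₁ * max CTB₀ 0) * B₀ * B * (H : ℝ) ^ 2 * (1 + Real.log H) ^ 4 * β⁻¹ ^ 3 := by
    rw [mul_right_comm, h13, hu]; ring
  -- ### the Gaussian sizes
  have a₁ : gaussAvg β H (fun a => tripleForm T₀ (plaqVar H x μ ν a) ^ 2) ≤ u₁ ^ 2 := (h1 H hH β hβ B₀ T₀ hT₀ x μ ν).trans (le_of_eq hu₁2.symm)
  have a₂ : gaussAvg β H (fun a => (linCurvSq H q a - gaussAvg β H (linCurvSq H q)) ^ 2) ≤ u ^ 2 := by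
    refine (hV H hH β hβ q).trans (le_of_eq ?_)
    rw [hu2, div_eq_mul_inv, ← inv_pow]
  have a₃ : gaussAvg β H (fun a => (β * ∑ p ∈ PT, tripleForm (Tc p) (plaqVar H p.1 p.2.1.1 p.2.1.2 a)) ^ 2) ≤ v ^ 2 := by
    refine (hTB H hH β hβ B Tc hT).trans ?_
    rw [hv2, div_eq_mul_inv]
    have : CTB₀ * B ^ 2 * (H : ℝ) ^ 4 * (1 + Real.log H) ^ 3 * β⁻¹ = CTB₀ * (B ^ 2 * (H : ℝ) ^ 4 * (1 + Real.log H) ^ 3 * β⁻¹) := by ring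
    rw [this, show max CTB₀ 0 * B ^ 2 * (H : ℝ) ^ 4 * (1 + Real.log H) ^ 3 * β⁻¹ = max CTB₀ 0 * (B ^ 2 * (H : ℝ) ^ 4 * (1 + Real.log H) ^ 3 * β⁻¹) by ring]
    exact mul_le_mul_of_nonneg_right (le_max_left _ _) (by positivity)
  have n₁ : 0 ≤ gaussAvg β H (fun a => tripleForm T₀ (plaqVar H x μ ν a) ^ 2) := EdgeChartGaussian.gaussAvg_nonneg H hβ fun a => sq_nonneg _
  have n₂ : 0 ≤ gaussAvg β H (fun a => (linCurvSq H q a - gaussAvg β H (linCurvSq H q)) ^ 2) :=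
    EdgeChartGaussian.gaussAvg_nonneg H hβ fun a => sq_nonneg _
  have n₃ : 0 ≤ gaussAvg β H (fun a => (β * ∑ p ∈ PT, tripleForm (Tc p) (plaqVar H p.1 p.2.1.1 p.2.1.2 a)) ^ 2) :=
    EdgeChartGaussian.gaussAvg_nonneg H hβ fun a => sq_nonneg _
  -- Bonami–Nelson products (degrees `3,2 → 243`, `3,3 → 729`, `2,3 → 243`, `5,3 → 6561`)
  have H12 : gaussAvg β H (fun a => tripleForm T₀ (plaqVar H x μ ν a) ^ 2 * (linCurvSq H q a - gaussAvg β H (linCurvSq H q)) ^ 2) ≤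
      243 * (u₁ ^ 2 * u ^ 2) := by
    refine (gaussAvg_sq_mul_sq_le_of_polyCert H hβ hcX hcL).trans ?_
    rw [show ((3 : ℝ) ^ (3 + 2)) = 243 by norm_num, mul_assoc]
    exact mul_le_mul_of_nonneg_left (mul_le_mul a₁ a₂ n₂ (sq_nonneg u₁)) (by norm_num)
  have H13 : gaussAvg β H (fun a => tripleForm T₀ (plaqVar H x μ ν a) ^ 2 *
      (β * ∑ p ∈ PT, tripleForm (Tc p) (plaqVar H p.1 p.2.1.1 p.2.1.2 a)) ^ 2) ≤ 729 * (u₁ ^ 2 * v ^ 2) := by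
    refine (gaussAvg_sq_mul_sq_le_of_polyCert H hβ hcX hcP).trans ?_
    rw [show ((3 : ℝ) ^ (3 + 3)) = 729 by norm_num, mul_assoc]
    exact mul_le_mul_of_nonneg_left (mul_le_mul a₁ a₃ n₃ (sq_nonneg u₁)) (by norm_num)
  have H23 : gaussAvg β H (fun a => (linCurvSq H q a - gaussAvg β H (linCurvSq H q)) ^ 2 *
      (β * ∑ p ∈ PT, tripleForm (Tc p) (plaqVar H p.1 p.2.1.1 p.2.1.2 a)) ^ 2) ≤ 243 * (u ^ 2 * v ^ 2) := by
    refine (gaussAvg_sq_mul_sq_le_of_polyCert H hβ hcL hcP).trans ?_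
    rw [show ((3 : ℝ) ^ (2 + 3)) = 243 by norm_num, mul_assoc]
    exact mul_le_mul_of_nonneg_left (mul_le_mul a₂ a₃ n₃ (sq_nonneg u)) (by norm_num)
  have H123 : gaussAvg β H (fun a => (tripleForm T₀ (plaqVar H x μ ν a) * (linCurvSq H q a - gaussAvg β H (linCurvSq H q))) ^ 2 *
      (β * ∑ p ∈ PT, tripleForm (Tc p) (plaqVar H p.1 p.2.1.1 p.2.1.2 a)) ^ 2) ≤ 6561 * (243 * (u₁ ^ 2 * u ^ 2) * v ^ 2) := by
    refine (gaussAvg_sq_mul_sq_le_of_polyCert H hβ (polyCert_mul hcX hcL) hcP).trans ?_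
    rw [show ((3 : ℝ) ^ (3 + 2 + 3)) = 6561 by norm_num, mul_assoc]
    refine mul_le_mul_of_nonneg_left (mul_le_mul ?_ a₃ n₃ (by positivity)) (by norm_num)
    refine le_trans (le_of_eq ?_) H12
    exact congrArg _ (funext fun a => by ring)
  -- ### the transfer (✓`GaussRestrict.abs_tiltCum3_muSet_zero_sub_gaussAvg_centred_le`)
  have htr := GaussRestrict.abs_tiltCum3_muSet_zero_sub_gaussAvg_centred_le hβ hDm hτ hτ2 mX mL mP hBD0 hXD hLD hPD iX iL iP
    (A₁ := u₁ ^ 2) (A₂ := u ^ 2) (A₃ := v ^ 2) (A₁₂ := (16 * u₁ * u) ^ 2) (A₁₃ := (27 * u₁ * v) ^ 2) (A₂₃ := (16 * u * v) ^ 2)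
    (A₁₂₃ := (1263 * u₁ * u * v) ^ 2) ?_ a₂ ?_ ?_ ?_ ?_ ?_
  · simp only [hX0, hP0, sub_zero] at htr
    rw [Real.sqrt_sq hu₁0, Real.sqrt_sq hu0, Real.sqrt_sq hv0, Real.sqrt_sq (by positivity : (0 : ℝ) ≤ 16 * u₁ * u),
      Real.sqrt_sq (by positivity : (0 : ℝ) ≤ 27 * u₁ * v), Real.sqrt_sq (by positivity : (0 : ℝ) ≤ 16 * u * v),
      Real.sqrt_sq (by positivity : (0 : ℝ) ≤ 1263 * u₁ * u * v)] at htr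
    have hTE : _ ≤ Real.sqrt τ * (5816 * (u₁ * u * v)) := htr.trans (le_of_eq (by ring))
    have h1 : _ ≤ Real.sqrt τ * (5816 * (u₁ * u * v)) := (abs_sub_abs_le_abs_sub _ _).trans hTE
    have hEx := hE H hH β hβ B₀ B T₀ hT₀ Tc hT q x μ ν
    rw [huv] at h1
    -- bookkeeping
    have hL45 : (1 + Real.log (H : ℝ)) ^ 4 ≤ (1 + Real.log (H : ℝ)) ^ 5 := pow_le_pow_right₀ hL1 (by norm_num)
    have hk : 0 ≤ Real.sqrt τ * (5816 * (Real.sqrt CV * Real.sqrt (C₁ * max CTB₀ 0) * B₀ * B * (H : ℝ) ^ 2)) * β⁻¹ ^ 3 := by positivity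
    have hstep : Real.sqrt τ * (5816 * (Real.sqrt CV * Real.sqrt (C₁ * max CTB₀ 0) * B₀ * B * (H : ℝ) ^ 2 * (1 + Real.log H) ^ 4 * β⁻¹ ^ 3)) ≤
        5816 * Real.sqrt CV * Real.sqrt (C₁ * max CTB₀ 0) * B₀ * B * (1 + Real.log H) ^ 5 * (Real.sqrt τ * (H : ℝ) ^ 2) * β⁻¹ ^ 3 := by
      calc Real.sqrt τ * (5816 * (Real.sqrt CV * Real.sqrt (C₁ * max CTB₀ 0) * B₀ * B * (H : ℝ) ^ 2 * (1 + Real.log H) ^ 4 * β⁻¹ ^ 3))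
          = Real.sqrt τ * (5816 * (Real.sqrt CV * Real.sqrt (C₁ * max CTB₀ 0) * B₀ * B * (H : ℝ) ^ 2)) * β⁻¹ ^ 3 * (1 + Real.log H) ^ 4 := by ring
        _ ≤ Real.sqrt τ * (5816 * (Real.sqrt CV * Real.sqrt (C₁ * max CTB₀ 0) * B₀ * B * (H : ℝ) ^ 2)) * β⁻¹ ^ 3 * (1 + Real.log H) ^ 5 :=
            mul_le_mul_of_nonneg_left hL45 hk
        _ = _ := by ring
    have hx1 : 0 ≤ CE * B₀ * B * (1 + Real.log H) ^ 5 * (Real.sqrt τ * (H : ℝ) ^ 2) * β⁻¹ ^ 3 := by positivity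
    have hx2 : 0 ≤ 5816 * Real.sqrt CV * Real.sqrt (C₁ * max CTB₀ 0) * B₀ * B * (1 + Real.log H) ^ 5 * β⁻¹ ^ 3 := by positivity
    have hexp : (CE + 5816 * Real.sqrt CV * Real.sqrt (C₁ * max CTB₀ 0)) * B₀ * B * (1 + Real.log H) ^ 5 * (1 + Real.sqrt τ * (H : ℝ) ^ 2) * β⁻¹ ^ 3 =
        CE * B₀ * B * (1 + Real.log H) ^ 5 * β⁻¹ ^ 3 +
          5816 * Real.sqrt CV * Real.sqrt (C₁ * max CTB₀ 0) * B₀ * B * (1 + Real.log H) ^ 5 * (Real.sqrt τ * (H : ℝ) ^ 2) * β⁻¹ ^ 3 +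
          (CE * B₀ * B * (1 + Real.log H) ^ 5 * (Real.sqrt τ * (H : ℝ) ^ 2) * β⁻¹ ^ 3 +
            5816 * Real.sqrt CV * Real.sqrt (C₁ * max CTB₀ 0) * B₀ * B * (1 + Real.log H) ^ 5 * β⁻¹ ^ 3) := by
      ring
    rw [hexp]
    calc _ ≤ Real.sqrt τ * (5816 * (Real.sqrt CV * Real.sqrt (C₁ * max CTB₀ 0) * B₀ * B * (H : ℝ) ^ 2 * (1 + Real.log H) ^ 4 * β⁻¹ ^ 3)) + _ :=
          sub_le_iff_le_add.mp h1
      _ ≤ 5816 * Real.sqrt CV * Real.sqrt (C₁ * max CTB₀ 0) * B₀ * B * (1 + Real.log H) ^ 5 * (Real.sqrt τ * (H : ℝ) ^ 2) * β⁻¹ ^ 3 +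
            CE * B₀ * B * (1 + Real.log H) ^ 5 * β⁻¹ ^ 3 := add_le_add hstep hEx
      _ = CE * B₀ * B * (1 + Real.log H) ^ 5 * β⁻¹ ^ 3 +
            5816 * Real.sqrt CV * Real.sqrt (C₁ * max CTB₀ 0) * B₀ * B * (1 + Real.log H) ^ 5 * (Real.sqrt τ * (H : ℝ) ^ 2) * β⁻¹ ^ 3 := add_comm _ _
      _ ≤ _ := le_add_of_nonneg_right (add_nonneg hx1 hx2)
  · simp only [hX0, sub_zero]
    exact a₁
  · simp only [hP0, sub_zero]
    exact a₃
  · simp only [hX0, sub_zero]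
    calc _ = gaussAvg β H (fun a => tripleForm T₀ (plaqVar H x μ ν a) ^ 2 * (linCurvSq H q a - gaussAvg β H (linCurvSq H q)) ^ 2) :=
          congrArg _ (funext fun a => by ring)
      _ ≤ 243 * (u₁ ^ 2 * u ^ 2) := H12
      _ ≤ 256 * (u₁ ^ 2 * u ^ 2) := mul_le_mul_of_nonneg_right (by norm_num) (mul_nonneg (sq_nonneg u₁) (sq_nonneg u))
      _ = (16 * u₁ * u) ^ 2 := by ring
  · simp only [hX0, hP0, sub_zero]
    calc _ = gaussAvg β H (fun a => tripleForm T₀ (plaqVar H x μ ν a) ^ 2 *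
          (β * ∑ p ∈ PT, tripleForm (Tc p) (plaqVar H p.1 p.2.1.1 p.2.1.2 a)) ^ 2) := congrArg _ (funext fun a => by ring)
      _ ≤ 729 * (u₁ ^ 2 * v ^ 2) := H13
      _ = (27 * u₁ * v) ^ 2 := by ring
  · simp only [hP0, sub_zero]
    calc _ = gaussAvg β H (fun a => (linCurvSq H q a - gaussAvg β H (linCurvSq H q)) ^ 2 *
          (β * ∑ p ∈ PT, tripleForm (Tc p) (plaqVar H p.1 p.2.1.1 p.2.1.2 a)) ^ 2) := congrArg _ (funext fun a => by ring)
      _ ≤ 243 * (u ^ 2 * v ^ 2) := H23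
      _ ≤ 256 * (u ^ 2 * v ^ 2) := mul_le_mul_of_nonneg_right (by norm_num) (mul_nonneg (sq_nonneg u) (sq_nonneg v))
      _ = (16 * u * v) ^ 2 := by ring
  · simp only [hX0, hP0, sub_zero]
    calc _ = gaussAvg β H (fun a => (tripleForm T₀ (plaqVar H x μ ν a) * (linCurvSq H q a - gaussAvg β H (linCurvSq H q))) ^ 2 *
          (β * ∑ p ∈ PT, tripleForm (Tc p) (plaqVar H p.1 p.2.1.1 p.2.1.2 a)) ^ 2) := congrArg _ (funext fun a => by ring)
      _ ≤ 6561 * (243 * (u₁ ^ 2 * u ^ 2) * v ^ 2) := H123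
      _ = 1594323 * (u₁ ^ 2 * u ^ 2 * v ^ 2) := by ring
      _ ≤ 1595169 * (u₁ ^ 2 * u ^ 2 * v ^ 2) :=
          mul_le_mul_of_nonneg_right (by norm_num) (mul_nonneg (mul_nonneg (sq_nonneg u₁) (sq_nonneg u)) (sq_nonneg v))
      _ = (1263 * u₁ * u * v) ^ 2 := by ring

/-- ★★ **K3′ row E2 on the cut set, cubic form in the second slot** (by the symmetry of `κ₃`). -/
theorem abs_tiltCum3_muSet_linCurvSq_tripleForm_le : ∃ C : ℝ, 0 ≤ C ∧ ∀ H : ℕ, 1 ≤ H → ∀ β : ℝ, 0 < β →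
    ∀ B₀ B : ℝ, ∀ T₀ : Fin 4 → Fin 4 → Fin 4 → ℝ, (∀ i j k, |T₀ i j k| ≤ B₀) →
    ∀ Tc : ZdPlaquette 4 → Fin 4 → Fin 4 → Fin 4 → ℝ, (∀ p i j k, |Tc p i j k| ≤ B) →
    ∀ x : Site 4, ∀ μ ν : Fin 4, ∀ y : Site 4, ∀ μ' ν' : Fin 4,
    ∀ s : ℝ, 0 ≤ s → ∀ D : Set (LandauFree H → E3), MeasurableSet D → D ⊆ smallField H s →
    ∀ τ : ℝ, gaussAvg β H (fun a => 1 - D.indicator (fun _ => (1 : ℝ)) a) ≤ τ → τ ≤ 1 / 2 →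
    |Tilt.tiltCum3 ((((volume : Measure (LandauFree H → E3)).restrict D).withDensity fun a => ENNReal.ofReal (gaussWeight β H a)))
        (fun a => β * ∑ p ∈ plaquettesTouching (boxEdges 4 (2 * H + 1)), tripleForm (Tc p) (plaqVar H p.1 p.2.1.1 p.2.1.2 a)) 0
        (linCurvSq H (y, μ', ν')) (fun a => tripleForm T₀ (plaqVar H x μ ν a))| ≤
      C * B₀ * B * (1 + Real.log H) ^ 5 * (1 + Real.sqrt τ * (H : ℝ) ^ 2) * β⁻¹ ^ 3 := by
  obtain ⟨C, hC0, h⟩ := abs_tiltCum3_muSet_tripleForm_linCurvSq_le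
  refine ⟨C, hC0, fun H hH β hβ B₀ B T₀ hT₀ Tc hT x μ ν y μ' ν' s hs0 D hDm hDs τ hτ hτ2 => ?_⟩
  rw [tiltCum3_comm]
  exact h H hH β hβ B₀ B T₀ hT₀ Tc hT x μ ν y μ' ν' s hs0 D hDm hDs τ hτ hτ2

/-! ## §3 The row, in the letters of ✓`GaussRestrict.abs_tiltCum3_muSet_zero_le_rows` -/

/-- ★★ **K3′ ROW E2 on the cut set**: with `Lz = linCurvSq H (plaq12At z)`, `Cz a = tripleForm (T z) (plaqVar H z 1 2 a)` (`|T z| ≤ B₀`) and the cubic vertex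
`P a = β·Σ_{p∈PT} tripleForm (Tc p) (plaqVar_p a)` (`|Tc p| ≤ B`), for every measurable `D ⊆ smallField H s` with `E₀[1 − 1_D] ≤ τ ≤ 1/2` and all `x y`:
`|κ₃,₀^{μ_D}(Cx, Ly; P) + κ₃,₀^{μ_D}(Lx, Cy; P)| ≤ 2·C·B₀·B·(1+log H)⁵·(1 + √τ·H²)·β⁻¹^3`. -/
theorem abs_tiltCum3_muSet_rowE2_le : ∃ C : ℝ, 0 ≤ C ∧ ∀ H : ℕ, 1 ≤ H → ∀ β : ℝ, 0 < β →
    ∀ B₀ B : ℝ, ∀ T : Site 4 → Fin 4 → Fin 4 → Fin 4 → ℝ, (∀ z i j k, |T z i j k| ≤ B₀) →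
    ∀ Tc : ZdPlaquette 4 → Fin 4 → Fin 4 → Fin 4 → ℝ, (∀ p i j k, |Tc p i j k| ≤ B) →
    ∀ s : ℝ, 0 ≤ s → ∀ D : Set (LandauFree H → E3), MeasurableSet D → D ⊆ smallField H s →
    ∀ τ : ℝ, gaussAvg β H (fun a => 1 - D.indicator (fun _ => (1 : ℝ)) a) ≤ τ → τ ≤ 1 / 2 → ∀ x y : Site 4,
    |Tilt.tiltCum3 ((((volume : Measure (LandauFree H → E3)).restrict D).withDensity fun a => ENNReal.ofReal (gaussWeight β H a)))
        (fun a => β * ∑ p ∈ plaquettesTouching (boxEdges 4 (2 * H + 1)), tripleForm (Tc p) (plaqVar H p.1 p.2.1.1 p.2.1.2 a)) 0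
        (fun a => tripleForm (T x) (plaqVar H x 1 2 a)) (linCurvSq H (plaq12At y)) +
      Tilt.tiltCum3 ((((volume : Measure (LandauFree H → E3)).restrict D).withDensity fun a => ENNReal.ofReal (gaussWeight β H a)))
        (fun a => β * ∑ p ∈ plaquettesTouching (boxEdges 4 (2 * H + 1)), tripleForm (Tc p) (plaqVar H p.1 p.2.1.1 p.2.1.2 a)) 0
        (linCurvSq H (plaq12At x)) (fun a => tripleForm (T y) (plaqVar H y 1 2 a))| ≤
      2 * (C * B₀ * B * (1 + Real.log H) ^ 5 * (1 + Real.sqrt τ * (H : ℝ) ^ 2) * β⁻¹ ^ 3) := by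
  obtain ⟨C, hC0, h₁⟩ := abs_tiltCum3_muSet_tripleForm_linCurvSq_le
  refine ⟨C, hC0, fun H hH β hβ B₀ B T hT₀ Tc hT s hs0 D hDm hDs τ hτ hτ2 x y => ?_⟩
  have ha := h₁ H hH β hβ B₀ B (T x) (hT₀ x) Tc hT x 1 2 y 1 2 s hs0 D hDm hDs τ hτ hτ2
  have hb := h₁ H hH β hβ B₀ B (T y) (hT₀ y) Tc hT y 1 2 x 1 2 s hs0 D hDm hDs τ hτ hτ2
  rw [tiltCum3_comm] at hb
  have e : ∀ z : Site 4, plaq12At z = (z, 1, 2) := fun z => rfl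
  simp only [e]
  exact (abs_add_le _ _).trans (by linarith)

end EdgeChartGaussian

end Summit.QuantumFields.YangMills.Theorems.AllWindowsColdBoxBoxHighLine

end
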